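import Summits.QuantumFields.YangMills.Theorems.Y2BridgeKing
import HarnessLib

/-!
# Route `F4SubCurvatureDoor`, crux `SubCurvatureKernel` ⟨stmt-QuantumFields-23036⟩ — KING FAITHFULNESS of a representing kernel

Helper file (`--supports stmt-QuantumFields-23036 --as helper`; free-hands seat `ym-line-frs-p2` g17, clause (F) of the soft-half
scope, HOME INBOX 2026-08-29T16:34:27Z).  Definition-free, KERNEL-GENERIC (no lattice input), 0 sorry, standard axioms.  No item is
closed; no summit, no crux and no mass gap is proved by this file.

WHAT.  Clauses 6 and 7 of `SubCurvatureKernel` (route file `Theses/F4SubCurvatureDoor.lean` :338ff) ask for a kernel `K` that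
REPRESENTS the two-point functional on compactly supported off-diagonal test functions,
`S₂ F = ∫ K(x₀ − x₁) F(x) dx`, and is FAITHFUL ON KING GERMS: for every `ρ > 0` and every linear isometry `R`,
`(∀ F ∈ KingClass 2 ρ, S₂ (R·F) = S₂ F) ↔ (∀ x ≠ 0, ‖x‖ < ρ → K (R x) = K x)`.  This file proves that clause 7 FOLLOWS from
clause 6 for every kernel continuous off the origin — so the soft kernel of the crux owes only the representation, and the traffic
between the S₁-level statements of the door (`TrialityLimit`, `NPointStepF4`: invariance on King's class) and its kernel-level
statement (✓`ShortRootRigidity`: `K ∘ R = K` on the punctured ball) is a tree theorem in both directions: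

* `apply_linActMulti_eq_of_kernel` (⇐): `K ∘ R = K` on the punctured `ρ`-ball ⇒ `S₂ (R·F) = S₂ F` on `KingClass 2 ρ` — change of
  variables under the diagonal action (✓`Mopup.integral_mul_linActMulti`), the support of `F` lying at `0 < ‖x₀ − x₁‖ < ρ`;
* `kernel_eq_of_apply_linActMulti_eq` (⇒): invariance on `KingClass 2 ρ` ⇒ `K ∘ R = K` on the punctured ball — test functions
  `F(x) = g(x₀ − x₁)·χ(x₁)` (`g` smooth with compact support in the punctured ball, `χ` a normed bump; Mathlib
  `HasCompactSupport.toSchwartzMap`) lie in King's class; `S₂ (R·F) − S₂ F = ∫∫ D(x₀ − x₁) g(x₀ − x₁) χ(x₁) = (∫ χ)(∫ D·g)` with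
  `D = K ∘ R − K` (Fubini + translation invariance of Lebesgue measure); so `∫ g·D = 0` for all such `g`, whence `D = 0` a.e. on the
  punctured ball (`IsOpen.ae_eq_zero_of_integral_contDiff_smul_eq_zero`) and everywhere there by continuity
  (`Measure.eqOn_open_of_ae_eq`);
* `faithful_of_kernel` (⇔, clause 7 verbatim from clause 6 + continuity off `0`).

References: C. King, CMP 103 (1986) §2 (finite-angle identities on a germ); K. Osterwalder, R. Schrader, CMP 31 (1973) §2;
L. Hörmander, ALPDO I, Thm 1.2.5 (fundamental lemma of the calculus of variations).

HONEST LABEL: clause (F) of the SOFT half of ⟨23036⟩ only, for a GIVEN representing kernel; kernel extraction (K), continuity (C)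
and the SUB-CURVATURE clause (asymptotic freedom) remain OPEN; ⟨23036⟩ is an open problem; the Yang–Mills mass gap is NOT proved;
no summit is proved by a line.
-/

set_option autoImplicit false

noncomputable section

open scoped SchwartzMap BigOperators ContDiff
open MeasureTheory Filter Topology Set
open Literature.MathematicalPhysics.QuantumFieldTheory Literature.MathematicalPhysics.QuantumLattice
open Literature.MathematicalPhysics.AQFT
open Summit.QuantumFields.YangMills.Cruxes.OSLegsAtWeakCouplingC.Sketch (Separated SmallDiam)
open Summit.QuantumFields.YangMills.Cruxes.OSLegsAtWeakCouplingC.Y2Bridge (King.KingClass King.linActMulti_mem_kingClass)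
open Summit.QuantumFields.YangMills.Theorems.OSLegsAtWeakCouplingC (linActMulti_hasCompactSupport)
open Summit.QuantumFields.YangMills.Theorems.OSLegsFromFemtoAndGap.Upgrade (isOffDiagonal_linActMulti)
open Summit.QuantumFields.YangMills.Theorems.NPointIsotropy.ComplexRotationBandlimit.Mopup
  (measurePreserving_diag integral_mul_linActMulti)
open Summit.QuantumFields.YangMills.Theorems.NPointIsotropy.Negative (E4)

namespace Summit.QuantumFields.YangMills.Theorems.F4SubCurvatureDoorSubCurvatureKernelFaithful

/-! ## ⇐ : kernel invariance on the punctured ball gives invariance on King's class -/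

/-- On the support of a King-class test function the difference variable lies in the punctured `ρ`-ball. -/
theorem sub_mem_puncturedBall_of_mem_tsupport {ρ : ℝ} {F : 𝓢((Fin 2 → E4), ℂ)} (hF : F ∈ King.KingClass 2 ρ)
    {y : Fin 2 → E4} (hy : y ∈ tsupport (F : (Fin 2 → E4) → ℂ)) : y 0 - y 1 ≠ 0 ∧ ‖y 0 - y 1‖ < ρ := by
  obtain ⟨-, -, ⟨δ, hδ, hFδ⟩, hFρ⟩ := hF
  have h01 : (0 : Fin 2) ≠ 1 := by decide
  refine ⟨fun h => ?_, ?_⟩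
  · have hsep : δ ≤ dist (y 0) (y 1) := hFδ hy 0 1 h01
    rw [dist_eq_norm, h, norm_zero] at hsep
    exact absurd hsep (not_le.2 hδ)
  · have hsm : dist (y 0) (y 1) < ρ := hFρ hy 0 1
    rwa [dist_eq_norm] at hsm

/-- **⇐ of clause 7.**  If `K ∘ R = K` on the punctured `ρ`-ball and `K` represents `S₂` on compactly supported off-diagonal test
functions, then `S₂ (R·F) = S₂ F` for every `F ∈ KingClass 2 ρ` (change of variables under the diagonal action; the support of `F`
sees only difference vectors in the punctured ball). [cite: King1986, §2] [cite: OS1973, §2] -/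
theorem apply_linActMulti_eq_of_kernel (K : E4 → ℝ) (S₂ : 𝓢((Fin 2 → E4), ℂ) →L[ℂ] ℂ)
    (hrep : ∀ F : 𝓢((Fin 2 → E4), ℂ), IsOffDiagonal F → HasCompactSupport (F : (Fin 2 → E4) → ℂ) →
      Integrable (fun x : Fin 2 → E4 => (K (x 0 - x 1) : ℂ) * F x) ∧
        S₂ F = ∫ x : Fin 2 → E4, (K (x 0 - x 1) : ℂ) * F x)
    {ρ : ℝ} (R : E4 ≃ₗᵢ[ℝ] E4) (hK : ∀ x : E4, x ≠ 0 → ‖x‖ < ρ → K (R x) = K x)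
    (F : 𝓢((Fin 2 → E4), ℂ)) (hF : F ∈ King.KingClass 2 ρ) : S₂ (linActMulti R F) = S₂ F := by
  have hRF : linActMulti R F ∈ King.KingClass 2 ρ := King.linActMulti_mem_kingClass hF R
  obtain ⟨-, h2⟩ := hrep _ hRF.1 hRF.2.1
  obtain ⟨-, h1⟩ := hrep F hF.1 hF.2.1
  rw [h2, h1, ← integral_mul_linActMulti R (fun x : Fin 2 → E4 => (K (x 0 - x 1) : ℂ)) F]
  refine integral_congr_ae (Eventually.of_forall fun y => ?_)
  by_cases hy : F y = 0
  · simp only [hy, mul_zero]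
  · have hyt : y ∈ tsupport (F : (Fin 2 → E4) → ℂ) := subset_tsupport _ hy
    obtain ⟨hne, hlt⟩ := sub_mem_puncturedBall_of_mem_tsupport hF hyt
    simp only [← map_sub, hK _ hne hlt]

/-! ## ⇒ : invariance on King's class gives kernel invariance on the punctured ball -/

/-- A continuous function on an open set times a continuous function supported inside it is continuous everywhere. -/
theorem continuous_mul_of_tsupport_subset {U : Set E4} (hU : IsOpen U) {D g : E4 → ℝ} (hD : ContinuousOn D U)
    (hg : Continuous g) (hgU : tsupport g ⊆ U) : Continuous fun u => g u * D u := by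
  refine continuous_iff_continuousAt.2 fun x => ?_
  by_cases hx : x ∈ U
  · exact hg.continuousAt.mul (hD.continuousAt (hU.mem_nhds hx))
  · have hx' : x ∉ tsupport g := fun h => hx (hgU h)
    have h0 : g =ᶠ[𝓝 x] 0 := notMem_tsupport_iff_eventuallyEq.1 hx'
    have h0' : (fun u => g u * D u) =ᶠ[𝓝 x] fun _ => 0 := h0.mono fun y hy => by simp [hy]
    exact (continuousAt_const.congr_of_eventuallyEq h0' :)

/-- **Fubini + translation invariance**: for integrable `χ, ψ : ℝ⁴ → ℝ`,
`∫_{(ℝ⁴)²} χ(y₁) ψ(y₀ − y₁) dy = (∫ χ)(∫ ψ)`. [folklore] -/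
theorem integral_fin_two_shear (χ ψ : E4 → ℝ) (hχ : Integrable χ) (hψ : Integrable ψ) :
    ∫ y : Fin 2 → E4, χ (y 1) * ψ (y 0 - y 1) = (∫ v, χ v) * ∫ u, ψ u := by
  have step1 : ∫ y : Fin 2 → E4, χ (y 1) * ψ (y 0 - y 1) = ∫ p : E4 × E4, χ p.2 * ψ (p.1 - p.2) :=
    (volume_preserving_finTwoArrow E4).integral_comp' (f := MeasurableEquiv.finTwoArrow)
      (fun p : E4 × E4 => χ p.2 * ψ (p.1 - p.2))
  have hint : Integrable (fun p : E4 × E4 => χ p.2 * ψ (p.1 - p.2)) (volume.prod volume) := by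
    have h := hχ.convolution_integrand (ContinuousLinearMap.mul ℝ ℝ) hψ
    simpa only [ContinuousLinearMap.mul_apply'] using h
  rw [step1, show (volume : Measure (E4 × E4)) = volume.prod volume from rfl, integral_prod_symm _ hint]
  have inner : ∀ v : E4, ∫ u, χ v * ψ (u - v) = χ v * ∫ u, ψ u := fun v => by
    rw [integral_const_mul, integral_sub_right_eq_self ψ v]
  simp_rw [inner]
  rw [integral_mul_const]

/-- **⇒ of clause 7.**  If `K` (continuous off `0`) represents `S₂` on compactly supported off-diagonal test functions and
`S₂ (R·F) = S₂ F` for every `F ∈ KingClass 2 ρ`, then `K (R x) = K x` for all `0 < ‖x‖ < ρ`.  Test functions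
`F(y) = g(y₀ − y₁) χ(y₁)` with `g` smooth and compactly supported in the punctured ball, `χ` a normed bump; Fubini; the fundamental
lemma of the calculus of variations; continuity. [cite: King1986, §2] [cite: OS1973, §2] -/
theorem kernel_eq_of_apply_linActMulti_eq (K : E4 → ℝ) (hKc : ContinuousOn K {x | x ≠ 0})
    (S₂ : 𝓢((Fin 2 → E4), ℂ) →L[ℂ] ℂ)
    (hrep : ∀ F : 𝓢((Fin 2 → E4), ℂ), IsOffDiagonal F → HasCompactSupport (F : (Fin 2 → E4) → ℂ) →
      Integrable (fun x : Fin 2 → E4 => (K (x 0 - x 1) : ℂ) * F x) ∧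
        S₂ F = ∫ x : Fin 2 → E4, (K (x 0 - x 1) : ℂ) * F x)
    {ρ : ℝ} (hρ : 0 < ρ) (R : E4 ≃ₗᵢ[ℝ] E4) (hinv : ∀ F ∈ King.KingClass 2 ρ, S₂ (linActMulti R F) = S₂ F) :
    ∀ x : E4, x ≠ 0 → ‖x‖ < ρ → K (R x) = K x := by
  -- the punctured ball `U` and the defect `D = K ∘ R − K`, continuous on `U`
  set U : Set E4 := {x | x ≠ 0 ∧ ‖x‖ < ρ} with hU
  have hUo : IsOpen U := isOpen_ne.inter (isOpen_lt continuous_norm continuous_const)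
  set D : E4 → ℝ := fun x => K (R x) - K x with hD
  have hRne : ∀ x : E4, x ≠ 0 → R x ≠ 0 := fun x hx h0 => hx (by
    have h := R.norm_map x
    rw [h0, norm_zero] at h
    exact norm_eq_zero.1 h.symm)
  have hDc : ContinuousOn D U :=
    ((hKc.comp R.continuous.continuousOn fun x hx => hRne x hx.1).sub (hKc.mono fun x hx => hx.1))
  -- MAIN: `∫ g • D = 0` for every smooth `g` compactly supported in `U`
  have hmain : ∀ g : E4 → ℝ, ContDiff ℝ ∞ g → HasCompactSupport g → tsupport g ⊆ U → ∫ x, g x • D x = 0 := by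
    intro g hg hgc hgU
    rcases (tsupport g).eq_empty_or_nonempty with hempty | hne
    · have h0 : g = 0 := tsupport_eq_empty_iff.1 hempty
      simp [h0]
    -- the separation `δ = min ‖·‖` on the support of `g`
    obtain ⟨u₀, hu₀, hmin⟩ := hgc.isCompact.exists_isMinOn hne continuous_norm.continuousOn
    have hδ : 0 < ‖u₀‖ := norm_pos_iff.2 (hgU hu₀).1
    have hδle : ∀ u ∈ tsupport g, ‖u₀‖ ≤ ‖u‖ := fun u hu => hmin hu
    -- a normed bump `χ` in the second variable
    let b : ContDiffBump (0 : E4) := ⟨1, 2, one_pos, one_lt_two⟩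
    set χ : E4 → ℝ := b.normed volume with hχ
    have hχs : ContDiff ℝ ∞ χ := b.contDiff_normed
    have hχc : HasCompactSupport χ := b.hasCompactSupport_normed
    have hχ1 : ∫ x, χ x = 1 := b.integral_normed
    have hχi : Integrable χ := b.integrable_normed
    -- the test function `f(y) = g(y₀ − y₁) χ(y₁)` and its Schwartz incarnation
    set f : (Fin 2 → E4) → ℂ := fun y => ((g (y 0 - y 1) * χ (y 1) : ℝ) : ℂ) with hf
    have h0 : ContDiff ℝ ∞ (fun y : Fin 2 → E4 => y 0) := contDiff_apply ℝ E4 0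
    have h1 : ContDiff ℝ ∞ (fun y : Fin 2 → E4 => y 1) := contDiff_apply ℝ E4 1
    have hfs : ContDiff ℝ ∞ f :=
      Complex.ofRealCLM.contDiff.comp (((hg.comp (h0.sub h1)).mul (hχs.comp h1)))
    have hθc : Continuous fun p : E4 × E4 => (![p.1 + p.2, p.2] : Fin 2 → E4) := by
      refine continuous_pi fun i => ?_
      fin_cases i
      · exact (continuous_fst.add continuous_snd).congr fun p => by simp
      · exact continuous_snd.congr fun p => by simp
    have hfval : ∀ y : Fin 2 → E4, f y ≠ 0 → g (y 0 - y 1) ≠ 0 ∧ χ (y 1) ≠ 0 := by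
      intro y hy
      constructor
      · intro h; apply hy; simp [hf, h]
      · intro h; apply hy; simp [hf, h]
    have hfc : HasCompactSupport f := by
      refine HasCompactSupport.intro ((hgc.isCompact.prod hχc.isCompact).image hθc) fun y hy => ?_
      by_contra hne'
      obtain ⟨hg', hχ'⟩ := hfval y hne'
      exact hy ⟨(y 0 - y 1, y 1), ⟨subset_tsupport _ hg', subset_tsupport _ hχ'⟩, by
        funext i; fin_cases i <;> simp⟩
    set F : 𝓢((Fin 2 → E4), ℂ) := hfc.toSchwartzMap hfs with hFdef
    have hFf : (F : (Fin 2 → E4) → ℂ) = f := rfl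
    -- the support of `F` sees only difference vectors in `tsupport g ⊆ U`
    have hT : tsupport (F : (Fin 2 → E4) → ℂ) ⊆ {y | y 0 - y 1 ∈ tsupport g ∧ y 1 ∈ tsupport χ} := by
      rw [hFf]
      refine closure_minimal (fun y hy => ?_) ?_
      · obtain ⟨hg', hχ'⟩ := hfval y hy
        exact ⟨subset_tsupport _ hg', subset_tsupport _ hχ'⟩
      · exact ((isClosed_tsupport _).preimage ((continuous_apply 0).sub (continuous_apply 1))).inter
          ((isClosed_tsupport _).preimage (continuous_apply 1))
    -- `F` lies in King's class at radius `ρ`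
    have hFK : F ∈ King.KingClass 2 ρ := by
      refine ⟨?_, hfc, ⟨‖u₀‖, hδ, ?_⟩, ?_⟩
      · refine IsOffDiagonal.of_tsupport_subset fun y hy hco => ?_
        obtain ⟨i, j, hij, hyij⟩ := (mem_coincidenceLocus y).1 hco
        have hne0 : y 0 - y 1 ≠ 0 := (hgU (hT hy).1).1
        have h01 : y 0 = y 1 := by
          fin_cases i <;> fin_cases j
          · exact absurd rfl hij
          · exact hyij
          · exact hyij.symm
          · exact absurd rfl hij
        exact hne0 (sub_eq_zero.2 h01)
      · intro y hy i j hij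
        have hδ' : ‖u₀‖ ≤ ‖y 0 - y 1‖ := hδle _ (hT hy).1
        fin_cases i <;> fin_cases j
        · exact absurd rfl hij
        · rwa [dist_eq_norm]
        · rw [dist_comm, dist_eq_norm]; exact hδ'
        · exact absurd rfl hij
      · intro y hy i j
        have hlt : ‖y 0 - y 1‖ < ρ := (hgU (hT hy).1).2
        fin_cases i <;> fin_cases j
        · simpa using hρ
        · rwa [dist_eq_norm]
        · rw [dist_comm, dist_eq_norm]; exact hlt
        · simpa using hρ
    -- `S₂ (R·F) − S₂ F = ∫ D(y₀ − y₁) F(y) dy`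
    have hRF : linActMulti R F ∈ King.KingClass 2 ρ := King.linActMulti_mem_kingClass hFK R
    obtain ⟨hI2, h2⟩ := hrep _ hRF.1 hRF.2.1
    obtain ⟨hI1, h1'⟩ := hrep F hFK.1 hfc
    have hcomp : (fun y : Fin 2 → E4 => (K (R (y 0 - y 1)) : ℂ) * F y) =
        (fun x : Fin 2 → E4 => (K (x 0 - x 1) : ℂ) * linActMulti R F x) ∘ fun (y : Fin 2 → E4) (k : Fin 2) => R (y k) := by
      funext y
      simp [linActMulti_apply, map_sub]
    have hI2' : Integrable (fun y : Fin 2 → E4 => (K (R (y 0 - y 1)) : ℂ) * F y) := by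
      rw [hcomp]
      exact (measurePreserving_diag R).integrable_comp_of_integrable hI2
    have h2' : S₂ (linActMulti R F) = ∫ y : Fin 2 → E4, (K (R (y 0 - y 1)) : ℂ) * F y := by
      rw [h2, ← integral_mul_linActMulti R (fun x : Fin 2 → E4 => (K (x 0 - x 1) : ℂ)) F]
      simp only [map_sub]
    have hzero : ∫ y : Fin 2 → E4, ((D (y 0 - y 1) : ℝ) : ℂ) * F y = 0 := by
      have h : ∫ y : Fin 2 → E4, ((D (y 0 - y 1) : ℝ) : ℂ) * F y = S₂ (linActMulti R F) - S₂ F := by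
        rw [h2', h1', ← integral_sub hI2' hI1]
        refine integral_congr_ae (Eventually.of_forall fun y => ?_)
        simp only [hD, Complex.ofReal_sub]
        ring
      rw [h, hinv F hFK, sub_self]
    -- the same integral is `(∫ χ)(∫ g • D) = ∫ g • D`
    set ψ : E4 → ℝ := fun u => g u * D u with hψ
    have hψc : Continuous ψ := continuous_mul_of_tsupport_subset hUo hDc hg.continuous hgU
    have hψi : Integrable ψ := hψc.integrable_of_hasCompactSupport hgc.mul_right
    have hreal : (fun y : Fin 2 → E4 => ((D (y 0 - y 1) : ℝ) : ℂ) * F y) =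
        fun y => ((χ (y 1) * ψ (y 0 - y 1) : ℝ) : ℂ) := by
      funext y
      rw [show F y = f y from rfl]
      simp only [hf, hψ]
      push_cast
      ring
    have hprod : ∫ y : Fin 2 → E4, ((D (y 0 - y 1) : ℝ) : ℂ) * F y = ((∫ u, ψ u : ℝ) : ℂ) := by
      rw [hreal, integral_complex_ofReal, integral_fin_two_shear χ ψ hχi hψi, hχ1, one_mul]
    have hψ0 : ∫ u, ψ u = 0 := by
      have h := hzero
      rw [hprod] at h
      exact_mod_cast h
    simpa only [hψ, smul_eq_mul] using hψ0
  -- the fundamental lemma: `D = 0` a.e. on `U`, hence everywhere on `U` by continuity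
  have hae : ∀ᵐ x ∂(volume : Measure E4), x ∈ U → D x = 0 :=
    hUo.ae_eq_zero_of_integral_contDiff_smul_eq_zero (hDc.locallyIntegrableOn hUo.measurableSet) hmain
  have hEq : EqOn D (fun _ => 0) U := by
    refine Measure.eqOn_open_of_ae_eq (μ := (volume : Measure E4)) ?_ hUo hDc continuousOn_const
    exact (ae_restrict_iff' hUo.measurableSet).2 hae
  intro x hx hxρ
  have h := hEq ⟨hx, hxρ⟩
  simpa only [hD, sub_eq_zero] using h

/-! ## ⇔ : clause 7 of `SubCurvatureKernel` from clause 6 -/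

/-- ★ **KING FAITHFULNESS of a representing kernel** — clause 7 of `SubCurvatureKernel` from clause 6, for every kernel continuous off
the origin: for every `ρ > 0` and every linear isometry `R`, the two-point functional is `R`-invariant on `KingClass 2 ρ` iff
`K ∘ R = K` on the punctured `ρ`-ball. [cite: King1986, §2] [cite: OS1973, §2] -/
theorem faithful_of_kernel (K : E4 → ℝ) (hKc : ContinuousOn K {x | x ≠ 0}) (S₂ : 𝓢((Fin 2 → E4), ℂ) →L[ℂ] ℂ)
    (hrep : ∀ F : 𝓢((Fin 2 → E4), ℂ), IsOffDiagonal F → HasCompactSupport (F : (Fin 2 → E4) → ℂ) →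
      Integrable (fun x : Fin 2 → E4 => (K (x 0 - x 1) : ℂ) * F x) ∧
        S₂ F = ∫ x : Fin 2 → E4, (K (x 0 - x 1) : ℂ) * F x) :
    ∀ ρ : ℝ, 0 < ρ → ∀ R : E4 ≃ₗᵢ[ℝ] E4,
      (∀ F ∈ King.KingClass 2 ρ, S₂ (linActMulti R F) = S₂ F) ↔ (∀ x : E4, x ≠ 0 → ‖x‖ < ρ → K (R x) = K x) :=
  fun _ hρ R =>
    ⟨kernel_eq_of_apply_linActMulti_eq K hKc S₂ hrep hρ R,
      fun hK F hF => apply_linActMulti_eq_of_kernel K S₂ hrep R hK F hF⟩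

end Summit.QuantumFields.YangMills.Theorems.F4SubCurvatureDoorSubCurvatureKernelFaithful

end
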